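/-
Copyright (c) 2026 the pub-hodgecm-mathlib formalisation cell (harness21).  Prover seat hodgecm-mathlib-K2E1-p02 (g5), Track B ∕ K2-LIT,
h413 = `stmt-HodgeConjecture-24833`, line `K2_E1_TraceFormulaBeta`, «EIS-RANK-ONE» rung R2 at `N = 2`: Godement's criterion for the Borel Eisenstein series of
`U(J₂)` in the campaign's tokens `eisensteinSeriesU (flatSectionU φ z)` (★ p857359), FROM ★ p857351 `borelEisenstein_summable` (K2Liu #9 at `n = 1`).  2026-09-04.
-/
import Summits.HodgeConjecture.HodgeConjecture.Theorems.K2E1BorelEisensteinU2FromK2LiuTransport   -- ★ p857351 (part 2): `borelEisenstein_summable`, literal `Φ₂`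
import Summits.HodgeConjecture.HodgeConjecture.Theorems.K2E1BorelEisensteinUDefs               -- ★ p857359 (K2E1-p08 (g4)): `eisensteinSeriesU`, `flatSectionU`, `norm_flatSectionU`
import Literature.NumberTheory.Automorphic.UnitaryGroupBorelSemidirect                          -- ★ `diagUnit`, `torusPart`, `adelicVal_torusPart`
import HarnessLib

/-!
# h413 ∕ Track B «K2-LIT», «EIS-RANK-ONE» R2 at `N = 2` — helper `K2E1BorelEisensteinGodementU2`:
# Godement's criterion for `E(f_z) = eisensteinSeriesU (flatSectionU φ z)` on `U(J₂)`, `1 < Re z`, FROM ★ `borelEisenstein_summable`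

Cell `pub/hodgecm-mathlib`, crux H413 = `stmt-HodgeConjecture-24833`, route `HCCMUnconditional`; chair K2-lead (g0); DEAL «K2Liu JUNCTION part 3 (3c)» of the dealer
K2E1-plan (g3) 2026-09-04T04:32:24Z, REPORT-FIRST 04:35:48Z «=» 04:36:43Z.  THEOREMS ONLY (no `def`, no `instance`, no `notation`, no named-fact hypothesis, no
`sorry`); lane `--kind proof --supports stmt-HodgeConjecture-24833 --as helper` (count-neutral).

THE THREE CURRENCY SEAMS between ★ p857351 `borelEisenstein_summable` (pinned to the LITERAL form `Φ₂ = Matrix.of …`, the involution `cmConjRingHom L`, and the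
K2Liu section law `F(b g) = χ(u) · (√‖u‖)^{2s+1} · F(g)`, `u = b₀₀`, `‖·‖ = GaloisRepresentations.ideleNorm` (ℝ)) and the campaign tokens of ★ p857359
(`quasiSplit L⁺ L c 2 = cmDatum L 2 ((StdForm.antidiagonal 2).over L)` by `rfl`, `(c : L →+* L)`, `flatSectionU φ z g = φ g · H(g)^z` with ★ `borelHeight` (ℝ≥0) and
★ `borelHeight_borel_mul : H(b g) = ‖b_{11}‖⁻¹ · H(g)` in `IdeleClassGroup.ideleNorm` (ℝ≥0)) are crossed here:

* §1 (any `N`) `lastEntryUnit_eq_diagUnit_top`, **`ideleNorm_lastEntryUnit_inv`** `‖b_{N-1,N-1}‖⁻¹ = ‖b₀₀‖` for `b ∈ B(𝔸_F)` (★ `borelHeight_torus_mul` vs ★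
  `borelHeight_torus_mul'` on the torus part ★ `torusPart`, cancelled at `g = 1`), **`borelHeight_borel_mul_eq_ideleNorm_diagUnit_zero`** `H(b g) = ‖b₀₀‖ · H(g)`
  (the FIRST-entry law every section law is written in) [Garrett (2018) §2.2; Rogawski (1990) §1.10, §2.2].
* §2 (analysis) `ofReal_sqrt_cpow_two_mul` `(√x)^{2z} = x^z`, `ofReal_sqrt_cpow_two_mul_add_one` `(√x)^{2s+1} = x^{s+½}` (`0 ≤ x`; Mathlib `Complex.cpow_mul`).
* §3 (`N = 2`, `L` CM) `mem_borelAdelic_two_iff` (`b ∈ B(𝔸) ⟺ b₁₀ = 0`), **`flatSectionU_borel_mul_two`** — for `φ(b g) = χ(b₀₀) φ(g)` (`b ∈ B(𝔸)`) the flat section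
  `f_z = flatSectionU φ z` obeys `f_z(b g) = χ(u) · ‖u‖^z · f_z(g)` (`u = b₀₀`, `b₁₀ = 0`), i.e. it IS a Borel section of `I(z − ½, χ)` in the K2Liu currency;
  **`summable_borelSection_two`** — ★ `borelEisenstein_summable` moved to the `over`∕`↑c` tokens (Mathlib `rw [antidiagOne_eq_over] at`, then `rfl`-transport);
  **`summable_eisensteinSeriesU_flatSectionU_two`** (THE HEAD, dealer's bytes) — `χ` unitary, `1 < Re z`, `φ` continuous with `φ(b g) = χ(diagUnit hb 0) φ(g)`:
  `Σ_q ‖f_z(γ̃_q g)‖ < ∞` for every `g`, the summands being literally those of ★ `eisensteinSeriesU_def` at `f = flatSectionU φ z`; `summable_flatSectionU_two`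
  (the complex-valued summands).  POINTWISE in `g` and `z` only: ★ K2Liu #9 is pointwise, so the LOCALLY UNIFORM MAJORANT that ★ R4a consumes is NOT exported here
  (dealer 04:36:43Z: it becomes the (G)-twin job at `N = 2`).

HONEST LABEL.  Count-neutral helper; proves no printed statement; HC_CM is proved only modulo the 7 printed citations (2 remaining named inputs: hLiu418 =
`stmt-HodgeConjecture-24832`, h413 = `stmt-HodgeConjecture-24833`) until rung 0 closes.

## References
* [MoeglinWaldspurger1995] C. Mœglin, J.-L. Waldspurger, *Spectral decomposition and Eisenstein series* (1995), II.1.5 (convergence of Eisenstein series).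
* [Garrett2018] P. Garrett, *Modern Analysis of Automorphic Forms by Example*, vol. 1 (2018), §2.2 (heights), §3.10 (Godement's criterion).
* [Rogawski1990] J. Rogawski, *Automorphic Representations of Unitary Groups in Three Variables* (1990), §1.10 (`B = TN`), §2.2.
-/

set_option autoImplicit false
set_option linter.dupNamespace false  -- the mandated namespace repeats the summit's segment (`HodgeConjecture.HodgeConjecture`)

noncomputable section

open scoped Matrix NNReal
open NumberField IsDedekindDomain MulAction
open Literature.NumberTheory.Automorphic Literature.NumberTheory.Automorphic.UnitaryGroup Literature.NumberTheory.GaloisRepresentations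
open Summit.HodgeConjecture.HodgeConjecture.Cruxes.H413.K2E1BorelEisensteinU2FromK2Liu
open Summit.HodgeConjecture.HodgeConjecture.Cruxes.H413.K2E1BorelEisensteinU2FromK2LiuTransport
open Summit.HodgeConjecture.HodgeConjecture.Cruxes.H413.K2E1BruhatCosetsU
open Summit.HodgeConjecture.HodgeConjecture.Cruxes.H413.K2E1BorelEisensteinU

namespace Summit.HodgeConjecture.HodgeConjecture.Cruxes.H413.K2E1BorelEisensteinGodementU2

/-! ## §1 The first-entry form of the Borel law of the height (any `N`) -/

section AnyRank

variable {F E : Type} [Field F] [NumberField F] [Field E] [NumberField E] [Algebra F E] {c : E ≃ₐ[F] E} {N : ℕ} [NeZero N]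

/-- `lastEntryUnit hb = diagUnit hb ⊤` — the two idele packagings of the last diagonal entry `b_{N-1,N-1}` of `b ∈ B(𝔸_F)` agree (definitionally).
[cite: Rogawski1990, §1.10] -/
theorem lastEntryUnit_eq_diagUnit_top {b : (quasiSplit F E c N).Adelic} (hb : b ∈ borelAdelic F E c N) :
    lastEntryUnit hb = diagUnit hb ⊤ := Units.ext rfl

/-- **`‖b_{N-1,N-1}‖_𝔸⁻¹ = ‖b₀₀‖_𝔸` for `b ∈ B(𝔸_F)`** (the unitary relation `c(b_{N-1,N-1}) · b₀₀ = 1` on the torus part `diag(bᵢᵢ) ∈ T(𝔸_F)` and the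
`Aut(E/F)`-invariance of the idele norm — read off by comparing ★ `borelHeight_torus_mul` with ★ `borelHeight_torus_mul'` at `g = 1`). [cite: Rogawski1990, §2.2] -/
theorem ideleNorm_lastEntryUnit_inv {b : (quasiSplit F E c N).Adelic} (hb : b ∈ borelAdelic F E c N) :
    (IdeleClassGroup.ideleNorm E (lastEntryUnit hb))⁻¹ = IdeleClassGroup.ideleNorm E (diagUnit hb 0) := by
  have hd : glDiagonal N (AdeleRing (𝓞 E) E) (diagUnit hb) =
      adelicVal F E c N _ ((torusPart ⟨b, hb⟩ : borelAdelic F E c N) : (quasiSplit F E c N).Adelic) :=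
    (adelicVal_torusPart ⟨b, hb⟩).symm
  have h1 := borelHeight_torus_mul hd 1
  have h2 := borelHeight_torus_mul' hd 1
  rw [h1] at h2
  have hpos : borelHeight (1 : (quasiSplit F E c N).Adelic) ≠ 0 := by
    rw [borelHeight_def]
    exact inv_ne_zero (vecHeight_lastRow_pos _).ne'
  rw [lastEntryUnit_eq_diagUnit_top]
  exact mul_right_cancel₀ hpos h2

/-- **`H(b g) = ‖b₀₀‖_{𝔸_E} · H(g)` for `b ∈ B(𝔸_F)`** — ★ `borelHeight_borel_mul` in the FIRST-entry currency in which section laws `f(b g) = χ(b₀₀)‖b₀₀‖^z f(g)`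
are written (Garrett (2018) §2.2; Rogawski (1990) §2.2 `H(a m n k) = log a`). [cite: Garrett2018, §2.2] -/
theorem borelHeight_borel_mul_eq_ideleNorm_diagUnit_zero {b : (quasiSplit F E c N).Adelic} (hb : b ∈ borelAdelic F E c N)
    (g : (quasiSplit F E c N).Adelic) :
    borelHeight (b * g) = IdeleClassGroup.ideleNorm E (diagUnit hb 0) * borelHeight g := by
  rw [borelHeight_borel_mul hb, ideleNorm_lastEntryUnit_inv hb]

end AnyRank

/-! ## §2 `(√x)^{2z} = x^z` -/

/-- `(√x)^{2z} = x^z` for a real `x ≥ 0` and complex `z` (Mathlib `Complex.cpow_mul`: `log √x · 2` is real). [folklore] -/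
theorem ofReal_sqrt_cpow_two_mul {x : ℝ} (hx : 0 ≤ x) (z : ℂ) :
    ((Real.sqrt x : ℝ) : ℂ) ^ (2 * z) = ((x : ℝ) : ℂ) ^ z := by
  have him : (Complex.log ((Real.sqrt x : ℝ) : ℂ) * 2).im = 0 := by
    rw [Complex.mul_im, Complex.log_im, Complex.arg_ofReal_of_nonneg (Real.sqrt_nonneg x)]
    simp
  rw [Complex.cpow_mul _ (by rw [him]; exact neg_lt_zero.2 Real.pi_pos) (by rw [him]; exact Real.pi_pos.le),
    Complex.cpow_two, ← Complex.ofReal_pow, Real.sq_sqrt hx]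

/-- `(√x)^{2s+1} = x^{s+½}` for a real `x ≥ 0` — the K2Liu ∕ Siegel exponent `(√‖u‖)^{2s+1}` is the flat-section exponent `‖u‖^z` at `z = s + ½`. [folklore] -/
theorem ofReal_sqrt_cpow_two_mul_add_one {x : ℝ} (hx : 0 ≤ x) (s : ℂ) :
    ((Real.sqrt x : ℝ) : ℂ) ^ (2 * s + 1) = ((x : ℝ) : ℂ) ^ (s + 1 / 2) := by
  rw [show (2 : ℂ) * s + 1 = 2 * (s + 1 / 2) by ring]
  exact ofReal_sqrt_cpow_two_mul hx _

/-! ## §3 `N = 2`: flat sections are Borel sections, and Godement's criterion in the campaign's tokens -/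

section RankOne

variable (L : Type) [Field L] [NumberField L] [IsCMField L]

/-- For `U(J₂)`: `b ∈ B(𝔸)` iff the corner entry `b₁₀` vanishes. [cite: Rogawski1990, §1.10] -/
theorem mem_borelAdelic_two_iff (b : (quasiSplit (↥(maximalRealSubfield L)) L (IsCMField.complexConj L) 2).Adelic) :
    b ∈ borelAdelic (↥(maximalRealSubfield L)) L (IsCMField.complexConj L) 2 ↔
      ((b.1 : GL (Fin 2) (AdeleRing (𝓞 L) L)) : Matrix (Fin 2) (Fin 2) (AdeleRing (𝓞 L) L)) 1 0 = 0 := by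
  rw [mem_borelAdelic_iff]
  constructor
  · intro h
    exact h (show (id (0 : Fin 2)) < id 1 by decide)
  · intro h i j hij
    fin_cases i <;> fin_cases j <;> simp_all [adelicVal_apply]

/-- **Flat sections are Borel sections (K2Liu currency)**: if `φ(b g) = χ(b₀₀) · φ(g)` for `b ∈ B(𝔸)`, then `f_z = flatSectionU φ z` satisfies
`f_z(b g) = χ(u) · ‖u‖^z · f_z(g)` whenever `b₁₀ = 0`, `u = b₀₀` (`H(b g) = ‖b₀₀‖ H(g)`, §1; `(‖u‖ H)^z = ‖u‖^z H^z` for nonnegative reals).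
[cite: MoeglinWaldspurger1995, II.1.5] -/
theorem flatSectionU_borel_mul_two (χ : HeckeCharacter L) (z : ℂ)
    {φ : (quasiSplit (↥(maximalRealSubfield L)) L (IsCMField.complexConj L) 2).Adelic → ℂ}
    (hφ : ∀ (b g : (quasiSplit (↥(maximalRealSubfield L)) L (IsCMField.complexConj L) 2).Adelic)
      (hb : b ∈ borelAdelic (↥(maximalRealSubfield L)) L (IsCMField.complexConj L) 2), φ (b * g) = ((χ (diagUnit hb 0) : ℂˣ) : ℂ) * φ g)
    (b g : (quasiSplit (↥(maximalRealSubfield L)) L (IsCMField.complexConj L) 2).Adelic) (u : (AdeleRing (𝓞 L) L)ˣ)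
    (h10 : ((b.1 : GL (Fin 2) (AdeleRing (𝓞 L) L)) : Matrix (Fin 2) (Fin 2) (AdeleRing (𝓞 L) L)) 1 0 = 0)
    (hu : (u : AdeleRing (𝓞 L) L) = ((b.1 : GL (Fin 2) (AdeleRing (𝓞 L) L)) : Matrix (Fin 2) (Fin 2) (AdeleRing (𝓞 L) L)) 0 0) :
    flatSectionU φ z (b * g) = ((χ u : ℂˣ) : ℂ) * ((ideleNorm u : ℝ) : ℂ) ^ z * flatSectionU φ z g := by
  have hb : b ∈ borelAdelic (↥(maximalRealSubfield L)) L (IsCMField.complexConj L) 2 := (mem_borelAdelic_two_iff L b).2 h10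
  have hu' : u = diagUnit hb 0 := Units.ext (by rw [hu, coe_diagUnit, adelicVal_apply])
  rw [flatSectionU_apply, flatSectionU_apply, hφ b g hb, borelHeight_borel_mul_eq_ideleNorm_diagUnit_zero hb g, NNReal.coe_mul,
    Complex.ofReal_mul, Complex.mul_cpow_ofReal_nonneg (NNReal.coe_nonneg _) (NNReal.coe_nonneg _), coe_ideleNorm, ← hu']
  ring

/-- **Godement's criterion for `U(J₂)`, K2Liu-shaped sections, campaign tokens** — ★ `borelEisenstein_summable` (★ K2Liu #9 at `n = 1`, transported in ★ p857351)
moved from the literal form `Φ₂ = Matrix.of …` ∕ `cmConjRingHom L` to `(StdForm.antidiagonal 2).over L` ∕ `↑(complexConj L)` (★ `antidiagOne_eq_over`; the rest is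
definitional): for `χ` unitary, `Re s > ½` and a continuous `F` with `F(b g) = χ(u)(√‖u‖)^{2s+1}F(g)` (`b₁₀ = 0`, `u = b₀₀`), `Σ_q |F(γ̃_q g)| < ∞` for every `g`.
[cite: MoeglinWaldspurger1995, II.1.5] -/
theorem summable_borelSection_two (χ : HeckeCharacter L) (hχ : χ.IsUnitary) (s : ℂ) (hs : (1 : ℝ) / 2 < s.re)
    {F : (quasiSplit (↥(maximalRealSubfield L)) L (IsCMField.complexConj L) 2).Adelic → ℂ} (hFc : Continuous F)
    (hF : ∀ (b g : (quasiSplit (↥(maximalRealSubfield L)) L (IsCMField.complexConj L) 2).Adelic) (u : (AdeleRing (𝓞 L) L)ˣ),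
      ((b.1 : GL (Fin 2) (AdeleRing (𝓞 L) L)) : Matrix (Fin 2) (Fin 2) (AdeleRing (𝓞 L) L)) 1 0 = 0 →
      (u : AdeleRing (𝓞 L) L) = ((b.1 : GL (Fin 2) (AdeleRing (𝓞 L) L)) : Matrix (Fin 2) (Fin 2) (AdeleRing (𝓞 L) L)) 0 0 →
        F (b * g) = ((χ u : ℂˣ) : ℂ) * ((Real.sqrt (ideleNorm u) : ℝ) : ℂ) ^ (2 * s + 1) * F g)
    (g : (quasiSplit (↥(maximalRealSubfield L)) L (IsCMField.complexConj L) 2).Adelic) :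
    Summable fun q : Quotient (orbitRel
        ↥(borelU ((IsCMField.complexConj L : L ≃ₐ[↥(maximalRealSubfield L)] L) : L →+* L) ((StdForm.antidiagonal 2).over L))
        ↥(unitaryGroupOfForm ((IsCMField.complexConj L : L ≃ₐ[↥(maximalRealSubfield L)] L) : L →+* L) ((StdForm.antidiagonal 2).over L))) =>
      ‖F ((quasiSplit (↥(maximalRealSubfield L)) L (IsCMField.complexConj L) 2).toAdelic
        (Quotient.out q : ↥(unitaryGroupOfForm ((IsCMField.complexConj L : L ≃ₐ[↥(maximalRealSubfield L)] L) : L →+* L) ((StdForm.antidiagonal 2).over L))) * g)‖ := by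
  have h := @borelEisenstein_summable L _ _ _
  rw [antidiagOne_eq_over (L := L) (N := 2)] at h
  exact h χ hχ s hs hFc hF g

/-- **THE HEAD (dealer's bytes 04:36:43Z): Godement's criterion for `E(f_z) = eisensteinSeriesU (flatSectionU φ z)` on `U(J₂)`** — for a unitary Hecke character
`χ` of `L`, `1 < Re z`, and a continuous `φ : U(J₂)(𝔸) → ℂ` with `φ(b g) = χ(b₀₀) φ(g)` for all `b ∈ B(𝔸)` (`b₀₀ = diagUnit hb 0`), the series of norms
`Σ_{q ∈ B(L⁺)\U(J₂)(L⁺)} ‖f_z(γ̃_q g)‖` converges for EVERY `g ∈ U(J₂)(𝔸)`, the summands being literally those of ★ `eisensteinSeriesU_def` at `f = flatSectionU φ z`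
(so `eisensteinSeriesU (flatSectionU φ z) g` is an absolutely convergent sum).  Proof: `z = s + ½`, `Re s > ½`; `f_z` is a Borel section of `I(s, χ)`
(`flatSectionU_borel_mul_two` + `(√‖u‖)^{2s+1} = ‖u‖^{s+½}`), continuous (★ `continuous_flatSectionU`); apply `summable_borelSection_two` (★ K2Liu #9).
POINTWISE in `(g, z)`: the locally uniform majorant of ★ R4a is not exported (★ #9 is pointwise). [cite: MoeglinWaldspurger1995, II.1.5] [cite: Garrett2018, §3.10] -/
theorem summable_eisensteinSeriesU_flatSectionU_two (χ : HeckeCharacter L) (hχ : χ.IsUnitary) {z : ℂ} (hz : 1 < z.re)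
    {φ : (quasiSplit (↥(maximalRealSubfield L)) L (IsCMField.complexConj L) 2).Adelic → ℂ} (hφc : Continuous φ)
    (hφ : ∀ (b g : (quasiSplit (↥(maximalRealSubfield L)) L (IsCMField.complexConj L) 2).Adelic)
      (hb : b ∈ borelAdelic (↥(maximalRealSubfield L)) L (IsCMField.complexConj L) 2), φ (b * g) = ((χ (diagUnit hb 0) : ℂˣ) : ℂ) * φ g)
    (g : (quasiSplit (↥(maximalRealSubfield L)) L (IsCMField.complexConj L) 2).Adelic) :
    Summable fun q : Quotient (orbitRel
        ↥(borelU ((IsCMField.complexConj L : L ≃ₐ[↥(maximalRealSubfield L)] L) : L →+* L) ((StdForm.antidiagonal 2).over L))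
        ↥(unitaryGroupOfForm ((IsCMField.complexConj L : L ≃ₐ[↥(maximalRealSubfield L)] L) : L →+* L) ((StdForm.antidiagonal 2).over L))) =>
      ‖flatSectionU φ z ((quasiSplit (↥(maximalRealSubfield L)) L (IsCMField.complexConj L) 2).toAdelic
        (Quotient.out q : ↥(unitaryGroupOfForm ((IsCMField.complexConj L : L ≃ₐ[↥(maximalRealSubfield L)] L) : L →+* L) ((StdForm.antidiagonal 2).over L))) * g)‖ := by
  obtain ⟨s, rfl⟩ : ∃ s : ℂ, z = s + 1 / 2 := ⟨z - 1 / 2, by ring⟩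
  have hs : (1 : ℝ) / 2 < s.re := by
    simp only [Complex.add_re, Complex.div_ofNat_re, Complex.one_re] at hz
    linarith
  refine summable_borelSection_two L χ hχ s hs (continuous_flatSectionU hφc _) (fun b g' u h10 hu => ?_) g
  rw [flatSectionU_borel_mul_two L χ (s + 1 / 2) hφ b g' u h10 hu, ofReal_sqrt_cpow_two_mul_add_one
    (show (0 : ℝ) ≤ ideleNorm u by rw [← coe_ideleNorm]; exact NNReal.coe_nonneg _)]

/-- The complex-valued summands of `eisensteinSeriesU (flatSectionU φ z) g` are summable under the hypotheses of `summable_eisensteinSeriesU_flatSectionU_two`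
(Mathlib `Summable.of_norm`). [cite: MoeglinWaldspurger1995, II.1.5] -/
theorem summable_flatSectionU_two (χ : HeckeCharacter L) (hχ : χ.IsUnitary) {z : ℂ} (hz : 1 < z.re)
    {φ : (quasiSplit (↥(maximalRealSubfield L)) L (IsCMField.complexConj L) 2).Adelic → ℂ} (hφc : Continuous φ)
    (hφ : ∀ (b g : (quasiSplit (↥(maximalRealSubfield L)) L (IsCMField.complexConj L) 2).Adelic)
      (hb : b ∈ borelAdelic (↥(maximalRealSubfield L)) L (IsCMField.complexConj L) 2), φ (b * g) = ((χ (diagUnit hb 0) : ℂˣ) : ℂ) * φ g)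
    (g : (quasiSplit (↥(maximalRealSubfield L)) L (IsCMField.complexConj L) 2).Adelic) :
    Summable fun q : Quotient (orbitRel
        ↥(borelU ((IsCMField.complexConj L : L ≃ₐ[↥(maximalRealSubfield L)] L) : L →+* L) ((StdForm.antidiagonal 2).over L))
        ↥(unitaryGroupOfForm ((IsCMField.complexConj L : L ≃ₐ[↥(maximalRealSubfield L)] L) : L →+* L) ((StdForm.antidiagonal 2).over L))) =>
      flatSectionU φ z ((quasiSplit (↥(maximalRealSubfield L)) L (IsCMField.complexConj L) 2).toAdelic
        (Quotient.out q : ↥(unitaryGroupOfForm ((IsCMField.complexConj L : L ≃ₐ[↥(maximalRealSubfield L)] L) : L →+* L) ((StdForm.antidiagonal 2).over L))) * g) :=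
  (summable_eisensteinSeriesU_flatSectionU_two L χ hχ hz hφc hφ g).of_norm

end RankOne

end Summit.HodgeConjecture.HodgeConjecture.Cruxes.H413.K2E1BorelEisensteinGodementU2

end
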